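import Summits.ValiantsHypothesis.ValiantsHypothesis.Theorems.DivisionGapPerDivisionHardStubTorusFamily

/-!
# Crux `DivisionGap.PerDivisionHard` (stmt-ValiantsHypothesis-5065), line
`pair-descent-jss-endpoint` — stub `stub_atomicTorus` (atomic rung, v7.1): the torus normal form
of an ATOMIC EXPRESSION, term by term and atom by atom

An atomic expression in the `n × n` matrix variables over `ℝ≥0` is a finite positive combination
`h = Σ_{l ∈ L} a_l · x^{C_l} · ∏_{β ∈ I} F_β ^ {μ_l β}` of monomial multiples of products of powers
of shared ATOMS `F_β ≠ 0`.  If `h ≠ 0`, there are a sub-family of terms `L' ⊆ L` and atoms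
`F'_β ≠ 0` that are TORUS-HOMOGENEOUS (`IsTorusHomogeneous`: all monomials share the row-margin
vector and the column-margin vector) with `supp F'_β ⊆ supp F_β`, such that the atomic expression
`h' = Σ_{l ∈ L'} a_l · x^{C_l} · ∏_{β ∈ I} F'_β ^ {μ_l β}` is nonzero, torus-homogeneous, and no
more expensive than `h` in either monotone complexity: `L(per_n · h') ≤ L(per_n · h)` and
`L(h') ≤ L(h)` (the tree's fan-in-two `complexity` over the semiring `ℝ≥0`).

This is the proof of `stub_torus` / `stub_torusFamily`
(`Theorems/DivisionGapPerDivisionHardStubTorus.lean`, `…StubTorusFamily.lean`) run on the atomic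
SHAPE.  For a weight `w`, the top component of an atomic expression over `ℝ≥0` is again atomic:
`top_w h = Σ_{l ∈ L_w} a_l · x^{C_l} · ∏_β (top_w F_β)^{μ_l β}` where `L_w ⊆ L` is the set of
effective terms of maximal `w`-degree (`topComponent_atomic`: `topComponent_list_sum` in `Finset`
form, `topComponent_mul`, `topComponent_finset_prod`, tops of powers and of monomials).  Row step:
with the digit weight `W_R : x_v ↦ B ^ (v.1)` for a COMMON radix `B > deg h, deg F_β` every row
margin of every monomial of `h` and of every atom is a base-`B` digit, so the monomials of
`top h` and of each `top F_β` have constant row margins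
(`mapDomain_eq_of_mem_support_topComponent_radix`); the permanent is `W_R`-homogeneous
(`isWeightedHomogeneous_perPoly_digitWeight`), so `top (per · h) = per · top h`
(`topComponent_mul`), and initial forms are free (`complexity_topComponent_le`).  Column step
identically with `Prod.snd` on the row-topped atomic expression; supports only shrink
(`support_topComponent_subset`), so the row margins stay constant. [folklore]
-/

noncomputable section

-- `Summit.ValiantsHypothesis.ValiantsHypothesis.…` is the tree's mandated single-conjunct layout
-- (Sub = Summit), so the duplicated namespace component is intended.
set_option linter.dupNamespace false

namespace Summit.ValiantsHypothesis.ValiantsHypothesis.Theorems.DivisionGapPerDivisionHard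

open MvPolynomial Literature.Computability.AlgebraicComplexity
open Summit.ValiantsHypothesis.ValiantsHypothesis.Theorems.ZeroOneTransfer.Negative
open scoped NNReal

/-! ### Top components of powers, monomials, finite weighted sums, atomic expressions -/

section TopComponent

variable {σ : Type*} (w : σ → ℕ)

/-- Top components of powers over `ℝ≥0`: `top (p ^ k) = (top p) ^ k` (`topComponent_mul`).
[folklore] -/
theorem topComponent_npow (p : MvPolynomial σ ℝ≥0) (k : ℕ) :
    topComponent w (p ^ k) = topComponent w p ^ k := by
  induction k with
  | zero => simp
  | succ k ih => rw [pow_succ, topComponent_mul, ih, pow_succ]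

/-- A monomial is its own top component. [folklore] -/
theorem topComponent_monomial (d : σ →₀ ℕ) (c : ℝ≥0) :
    topComponent w (monomial d c) = monomial d c :=
  topComponent_eq_self_of_isWeightedHomogeneous w (isWeightedHomogeneous_monomial w d c rfl)

open Classical in
/-- **Top component of a finite weighted sum over `ℝ≥0`** (`Finset` form of
`topComponent_list_sum`): keep exactly the effective summands whose weighted degree is that of
the whole sum, and top them. [folklore] -/
theorem topComponent_finset_sum {κ : Type*} (s : Finset κ) (a : κ → ℝ≥0)
    (g : κ → MvPolynomial σ ℝ≥0) :
    topComponent w (∑ l ∈ s, a l • g l) =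
      ∑ l ∈ s.filter (fun l => a l ≠ 0 ∧ g l ≠ 0 ∧
          weightedTotalDegree w (g l) = weightedTotalDegree w (∑ l ∈ s, a l • g l)),
        a l • topComponent w (g l) := by
  have h1 : ∑ l ∈ s, a l • g l =
      ((s.toList.map fun l => (a l, g l)).map fun b => b.1 • b.2).sum := by
    rw [List.map_map, Finset.sum_map_toList]
    rfl
  rw [h1, topComponent_list_sum, ← h1, List.filter_map, List.map_map, list_sum_map_filter,
    Finset.sum_map_toList, Finset.sum_filter]
  refine Finset.sum_congr rfl fun l _ => ?_
  simp only [Function.comp_apply, decide_eq_true_eq]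

open Classical in
/-- **Top component of an atomic expression over `ℝ≥0`**: for every weight `w`,
`top_w (Σ_{l ∈ L} a_l · x^{E_l} · ∏_β F_β^{μ_l β})` is the atomic expression
`Σ_{l ∈ L_w} a_l · x^{E_l} · ∏_β (top_w F_β)^{μ_l β}`, where `L_w ⊆ L` is the set of effective
terms of maximal `w`-degree (`topComponent_finset_sum`, `topComponent_mul`,
`topComponent_monomial`, `topComponent_finset_prod`, `topComponent_npow`). [folklore] -/
theorem topComponent_atomic {ι κ : Type*} (I : Finset ι) (L : Finset κ)
    (F : ι → MvPolynomial σ ℝ≥0) (a : κ → ℝ≥0) (E : κ → σ →₀ ℕ) (μ : κ → ι → ℕ) :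
    topComponent w (∑ l ∈ L, a l • (monomial (E l) (1 : ℝ≥0) * ∏ β ∈ I, F β ^ μ l β)) =
      ∑ l ∈ L.filter (fun l => a l ≠ 0 ∧
          (monomial (E l) (1 : ℝ≥0) * ∏ β ∈ I, F β ^ μ l β) ≠ 0 ∧
          weightedTotalDegree w (monomial (E l) (1 : ℝ≥0) * ∏ β ∈ I, F β ^ μ l β) =
            weightedTotalDegree w
              (∑ l ∈ L, a l • (monomial (E l) (1 : ℝ≥0) * ∏ β ∈ I, F β ^ μ l β))),
        a l • (monomial (E l) (1 : ℝ≥0) * ∏ β ∈ I, topComponent w (F β) ^ μ l β) := by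
  rw [topComponent_finset_sum]
  refine Finset.sum_congr rfl fun l _ => ?_
  rw [topComponent_mul, topComponent_monomial, topComponent_finset_prod]
  simp_rw [topComponent_npow]

open Classical in
/-- **Top component of an atomic expression over `ℝ≥0`, existential form**: `top_w` of an atomic
expression is an atomic expression over a sub-family `L' ⊆ L` of terms with every atom topped
(`topComponent_atomic`; the filter is hidden, so no decidability data leaks). [folklore] -/
theorem exists_topComponent_atomic {ι κ : Type*} (I : Finset ι) (L : Finset κ)
    (F : ι → MvPolynomial σ ℝ≥0) (a : κ → ℝ≥0) (E : κ → σ →₀ ℕ) (μ : κ → ι → ℕ) :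
    ∃ L' ⊆ L,
      topComponent w (∑ l ∈ L, a l • (monomial (E l) (1 : ℝ≥0) * ∏ β ∈ I, F β ^ μ l β)) =
        ∑ l ∈ L', a l • (monomial (E l) (1 : ℝ≥0) * ∏ β ∈ I, topComponent w (F β) ^ μ l β) :=
  ⟨_, Finset.filter_subset _ _, topComponent_atomic w I L F a E μ⟩

end TopComponent

/-! ### One degeneration step for an atomic expression, with a common radix -/

variable {n : ℕ}

/-- **One torus step, on the atomic shape.**  For a nonzero atomic expression
`h = Σ_{l ∈ L} a_l · x^{E_l} · ∏_{β ∈ I} F_β^{μ_l β}` with nonzero atoms and a map `f` enumerating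
`[n]` along every permutation monomial (rows `Prod.fst`, columns `Prod.snd`), let
`W : x_v ↦ B^{f v}` be the digit weight with the COMMON radix `B = deg h + Σ_{β ∈ I} deg F_β + 1`.
Then
`top_W h = Σ_{l ∈ L'} a_l · x^{E_l} · ∏_β (F'_β)^{μ_l β}` with `L' ⊆ L` and `F'_β := top_W F_β`
(`topComponent_atomic`); the `F'_β` are nonzero with supports inside those of the `F_β` and
constant `f`-margins, `top_W h` is nonzero with support inside that of `h` and constant
`f`-margins (`mapDomain_eq_of_mem_support_topComponent_radix`), and it costs nothing:
`L(per · top_W h) ≤ L(per · h)` (`top per = per`, `topComponent_mul`,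
`complexity_topComponent_le`) and `L(top_W h) ≤ L(h)`. [folklore] -/
theorem exists_atomic_topComponent_const_margins (f : Fin n × Fin n → Fin n)
    (hf : ∀ (B : ℕ) (π : Equiv.Perm (Fin n)),
      ∑ i : Fin n, B ^ ((f (π i, i) : Fin n) : ℕ) = ∑ a : Fin n, B ^ ((a : Fin n) : ℕ))
    {ι κ : Type*} (I : Finset ι) (L : Finset κ) {F : ι → MvPolynomial (Fin n × Fin n) ℝ≥0}
    (a : κ → ℝ≥0) (E : κ → (Fin n × Fin n) →₀ ℕ) (μ : κ → ι → ℕ) (hF : ∀ β ∈ I, F β ≠ 0)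
    (hh : (∑ l ∈ L, a l • (monomial (E l) (1 : ℝ≥0) * ∏ β ∈ I, F β ^ μ l β)) ≠ 0) :
    ∃ (L' : Finset κ) (F' : ι → MvPolynomial (Fin n × Fin n) ℝ≥0), L' ⊆ L ∧
      (∀ β ∈ I, F' β ≠ 0) ∧ (∀ β ∈ I, (F' β).support ⊆ (F β).support) ∧
      (∀ β ∈ I, ∀ m ∈ (F' β).support, ∀ m' ∈ (F' β).support,
        Finsupp.mapDomain f m = Finsupp.mapDomain f m') ∧
      (∑ l ∈ L', a l • (monomial (E l) (1 : ℝ≥0) * ∏ β ∈ I, F' β ^ μ l β)) ≠ 0 ∧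
      (∑ l ∈ L', a l • (monomial (E l) (1 : ℝ≥0) * ∏ β ∈ I, F' β ^ μ l β)).support ⊆
        (∑ l ∈ L, a l • (monomial (E l) (1 : ℝ≥0) * ∏ β ∈ I, F β ^ μ l β)).support ∧
      (∀ m ∈ (∑ l ∈ L', a l • (monomial (E l) (1 : ℝ≥0) * ∏ β ∈ I, F' β ^ μ l β)).support,
        ∀ m' ∈ (∑ l ∈ L', a l • (monomial (E l) (1 : ℝ≥0) * ∏ β ∈ I, F' β ^ μ l β)).support,
          Finsupp.mapDomain f m = Finsupp.mapDomain f m') ∧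
      complexity (perPoly (Fin n) ℝ≥0 *
          ∑ l ∈ L', a l • (monomial (E l) (1 : ℝ≥0) * ∏ β ∈ I, F' β ^ μ l β)) ≤
        complexity (perPoly (Fin n) ℝ≥0 *
          ∑ l ∈ L, a l • (monomial (E l) (1 : ℝ≥0) * ∏ β ∈ I, F β ^ μ l β)) ∧
      complexity (∑ l ∈ L', a l • (monomial (E l) (1 : ℝ≥0) * ∏ β ∈ I, F' β ^ μ l β)) ≤
        complexity (∑ l ∈ L, a l • (monomial (E l) (1 : ℝ≥0) * ∏ β ∈ I, F β ^ μ l β)) := by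
  set h := ∑ l ∈ L, a l • (monomial (E l) (1 : ℝ≥0) * ∏ β ∈ I, F β ^ μ l β)
  set B := h.totalDegree + (∑ β ∈ I, (F β).totalDegree) + 1
  set W : Fin n × Fin n → ℕ := fun v => B ^ ((f v : Fin n) : ℕ)
  have hdegh : h.totalDegree < B := Nat.lt_succ_of_le (Nat.le_add_right _ _)
  have hdegF : ∀ β ∈ I, (F β).totalDegree < B := fun β hβ =>
    Nat.lt_succ_of_le ((Finset.single_le_sum (f := fun β => (F β).totalDegree)
      (fun _ _ => Nat.zero_le _) hβ).trans (Nat.le_add_left _ _))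
  set F' : ι → MvPolynomial (Fin n × Fin n) ℝ≥0 := fun β => topComponent W (F β)
  obtain ⟨L', hL', hkey⟩ : ∃ L' ⊆ L, topComponent W h =
      ∑ l ∈ L', a l • (monomial (E l) (1 : ℝ≥0) * ∏ β ∈ I, F' β ^ μ l β) :=
    exists_topComponent_atomic W I L F a E μ
  refine ⟨L', F', hL', fun β hβ => topComponent_ne_zero W (hF β hβ),
    fun β _ => support_topComponent_subset W (F β),
    fun β hβ m hm m' hm' => mapDomain_eq_of_mem_support_topComponent_radix f (hdegF β hβ) hm hm',
    ?_, ?_, ?_, ?_, ?_⟩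
  · rw [← hkey]
    exact topComponent_ne_zero W hh
  · rw [← hkey]
    exact support_topComponent_subset W h
  · rw [← hkey]
    intro m hm m' hm'
    exact mapDomain_eq_of_mem_support_topComponent_radix f hdegh hm hm'
  · rw [← hkey]
    have := complexity_topComponent_le W (perPoly (Fin n) ℝ≥0 * h)
    rwa [topComponent_mul, topComponent_eq_self_of_isWeightedHomogeneous W
      (isWeightedHomogeneous_perPoly_digitWeight f _ (hf _))] at this
  · rw [← hkey]
    exact complexity_topComponent_le W h

/-! ### The stub -/

/-- **`stub_atomicTorus` (atomic rung of line `pair-descent-jss-endpoint` for `PerDivisionHard`,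
v7.1 — `stub_torusFamily` for sums of products).**  The torus normal form of a nonzero atomic
expression `Σ_{l ∈ L} a_l · x^{C_l} · ∏_{β ∈ I} F_β^{μ_l β}` with nonzero atoms is an atomic
expression over the SAME index sets with a sub-family `L' ⊆ L` of terms and every atom replaced by
a nonzero torus-homogeneous polynomial `F'_β` with `supp F'_β ⊆ supp F_β`; it is nonzero,
torus-homogeneous, and no more expensive in either monotone complexity (with and without the
factor `per_n`).  Two atomic initial-form steps with common radices
(`exists_atomic_topComponent_const_margins` for `Prod.fst`, then for `Prod.snd` on the row-topped
expression; supports only shrink, so the row margins stay constant), reading the margins off one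
monomial of each atom and of the expression. [folklore] -/
theorem stub_atomicTorus :
    ∀ (n : ℕ) (ι κ : Type) (I : Finset ι) (L : Finset κ)
      (F : ι → MvPolynomial (Fin n × Fin n) ℝ≥0) (a : κ → ℝ≥0) (C : κ → (Fin n × Fin n) →₀ ℕ)
      (μ : κ → ι → ℕ),
      (∀ β ∈ I, F β ≠ 0) →
      (∑ l ∈ L, a l • (monomial (C l) (1 : ℝ≥0) * ∏ β ∈ I, F β ^ μ l β)) ≠ 0 →
      ∃ (L' : Finset κ) (F' : ι → MvPolynomial (Fin n × Fin n) ℝ≥0),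
        L' ⊆ L ∧ (∀ β ∈ I, F' β ≠ 0) ∧ (∀ β ∈ I, IsTorusHomogeneous (F' β)) ∧
        (∀ β ∈ I, (F' β).support ⊆ (F β).support) ∧
        (∑ l ∈ L', a l • (monomial (C l) (1 : ℝ≥0) * ∏ β ∈ I, F' β ^ μ l β)) ≠ 0 ∧
        IsTorusHomogeneous
          (∑ l ∈ L', a l • (monomial (C l) (1 : ℝ≥0) * ∏ β ∈ I, F' β ^ μ l β)) ∧
        complexity (perPoly (Fin n) ℝ≥0 *
            ∑ l ∈ L', a l • (monomial (C l) (1 : ℝ≥0) * ∏ β ∈ I, F' β ^ μ l β)) ≤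
          complexity (perPoly (Fin n) ℝ≥0 *
            ∑ l ∈ L, a l • (monomial (C l) (1 : ℝ≥0) * ∏ β ∈ I, F β ^ μ l β)) ∧
        complexity (∑ l ∈ L', a l • (monomial (C l) (1 : ℝ≥0) * ∏ β ∈ I, F' β ^ μ l β)) ≤
          complexity (∑ l ∈ L, a l • (monomial (C l) (1 : ℝ≥0) * ∏ β ∈ I, F β ^ μ l β)) := by
  intro n ι κ I L F a C μ hF hh
  -- row step: `per` is row-homogeneous since `i ↦ π i` is a bijection
  obtain ⟨L₁, F₁, hL₁, hF₁, hsubF₁, hrowF, hh₁, -, hrow, hle₁, hle₁'⟩ :=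
    exists_atomic_topComponent_const_margins Prod.fst
      (fun B π => Equiv.sum_comp π (fun i : Fin n => B ^ ((i : Fin n) : ℕ))) I L a C μ hF hh
  -- column step: `per` is column-homogeneous trivially
  obtain ⟨L₂, F₂, hL₂, hF₂, hsubF₂, hcolF, hh₂, hsub₂, hcol, hle₂, hle₂'⟩ :=
    exists_atomic_topComponent_const_margins Prod.snd (fun B π => rfl) I L₁ a C μ hF₁ hh₁
  refine ⟨L₂, F₂, hL₂.trans hL₁, hF₂, fun β hβ => ?_,
    fun β hβ => (hsubF₂ β hβ).trans (hsubF₁ β hβ), hh₂, ?_, hle₂.trans hle₁,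
    hle₂'.trans hle₁'⟩
  · obtain ⟨d₀, hd₀⟩ := exists_coeff_ne_zero (hF₂ β hβ)
    have hd₀s : d₀ ∈ (F₂ β).support := mem_support_iff.mpr hd₀
    exact ⟨rowDegrees d₀, Finsupp.mapDomain Prod.snd d₀, fun m hm =>
      ⟨hrowF β hβ m (hsubF₂ β hβ hm) d₀ (hsubF₂ β hβ hd₀s), hcolF β hβ m hm d₀ hd₀s⟩⟩
  · obtain ⟨d₀, hd₀⟩ := exists_coeff_ne_zero hh₂
    have hd₀s := mem_support_iff.mpr hd₀
    exact ⟨rowDegrees d₀, Finsupp.mapDomain Prod.snd d₀, fun m hm =>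
      ⟨hrow m (hsub₂ hm) d₀ (hsub₂ hd₀s), hcol m hm d₀ hd₀s⟩⟩

end Summit.ValiantsHypothesis.ValiantsHypothesis.Theorems.DivisionGapPerDivisionHard

end
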